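import Mathlib.Algebra.Order.BigOperators.Ring.Finset
import Mathlib.Algebra.BigOperators.Ring.Finset
import Mathlib.Algebra.BigOperators.Field
import Mathlib.Analysis.SpecialFunctions.Gamma.Basic
import Mathlib.Data.Real.Basic
import Mathlib.Logic.Equiv.Defs
import Mathlib.Tactic.Linarith
import Mathlib.Tactic.Positivity
import Mathlib.Tactic.FieldSimp
import Mathlib.Tactic.Ring
import HarnessLib

/-!
# The reduction from XQUATH to XHOG (Aaronson–Gunn 2020, Theorem 1): the mean-squared-error gain

Topic `Literature/Computability/QuantumComplexity` (pub-qadeq lane, CLAIMS §5: the random-circuit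
sampling rows E-01…E-10 are scored by the linear cross-entropy benchmark, whose complexity-theoretic
frame — recorded as a theorem IN PRINT by the barrier file
`Literature/Barriers/QuantumAdvantage/LinearXEBSpoofing.lean` (“evasions_known := conditional
hardness of spoofing: XQUATH implies that no polynomial-time classical algorithm solves XHOG with
`b > 1` [AaronsonGunn2020, Thm 1]”) — is the reduction proved here; companions
`XEBSampleComplexity.lean` (how many samples certify a score) and `CrossEntropyEstimators.lean`).

HONEST FRAMING: instance-level adjudication of specific advantage claims; no claim about BQP vs BPP
or the summit.  This file proves the ARITHMETIC of Aaronson–Gunn's one-query reduction — the exact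
expected gain in mean squared error that an XHOG solver hands to an estimator of `p₀ = Pr[C outputs 0ⁿ]`
— for finitely supported ensembles; “polynomial time” enters the source's Theorem 1 only through
“we only call the XHOG algorithm once … and all other steps are efficient”, which is not a
mathematical statement and is not formalised.  Nothing here says XQUATH is true, or that any device
solves XHOG.

## Source [cite: AaronsonGunn2020, §2 Definition 1 (XQUATH), Problem 1 (XHOG); §3 Theorem 1 and its proof]

* XQUATH (Def. 1): no polynomial-time classical algorithm, given `C ← 𝒟`, outputs an estimate `p` of
  `p₀ = Pr[C outputs 0ⁿ]` with `𝔼[(p₀ − p)²] = 𝔼[(p₀ − 2⁻ⁿ)²] − Ω(2⁻³ⁿ)`.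
* XHOG (Problem 1): given `C`, generate `k` DISTINCT samples `z₁,…,z_k` with
  `𝔼ᵢ[|⟨zᵢ|C|0ⁿ⟩|²] ≥ b/2ⁿ`.
* Theorem 1: assuming XQUATH, no polynomial-time classical algorithm solves XHOG with probability
  `s > 1/2 + 1/(2b)` and `k ≥ 1/(((2s−1)b−1)(b−1))`.  Proof: draw `z` uniformly, append NOT gates to
  get `C'` (“`C'` is distributed exactly the same as `C` … `⟨0ⁿ|C|0ⁿ⟩ = ⟨z|C'|0ⁿ⟩`”), run the solver
  on `C'`, output `p = b2⁻ⁿ` if `z ∈ {zᵢ}` and `p = 2⁻ⁿ` otherwise; with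
  `X = (p₀ − 2⁻ⁿ)² − (p₀ − p)²`: `𝔼[X | z ∈ {zᵢ}, success] = 2·2⁻ⁿ(b−1)𝔼[p₀|…] + 2⁻²ⁿ(1−b²) ≥ 2⁻²ⁿ(b−1)²`,
  `𝔼[X | z ∈ {zᵢ}, failure] ≥ −2⁻²ⁿ(b²−1)`, `𝔼[X | z ∉ {zᵢ}] = 0`, hence
  `𝔼[X] ≥ 2⁻³ⁿ k((2s−1)b−1)(b−1)`; “one simple instance … `s = 3/4 + 1/(4b)` and `k = 2(b−1)⁻²`”.

## Contents (all proved, 0 named facts)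

Outcomes form any finite type `G` with `N = |G|` elements (`N = 2ⁿ`); an output distribution is
`p : G → ℝ`; the solver's answer is a `Finset G` (the DISTINCT samples).

* `xhogScore p S = (Σ_{z∈S} p z)/|S|` (`𝔼ᵢ|⟨zᵢ|C|0ⁿ⟩|²`), `agEstimate S b z` (the reduction's output
  `p`), `gain p S b z` (`X`, with `p₀ = p z`).
* `gain_of_not_mem` (`X = 0` off `S`), `gain_of_mem` (the first line of the display),
  **`avg_gain_eq`** (`𝔼_z X = (k/N)(2(b−1)/N · score + (1−b²)/N²)` for uniform `z`),
  `avg_gain_ge_of_solves` (`≥ k(b−1)²/N³` on success), `avg_gain_ge_of_nonneg`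
  (`≥ −k(b²−1)/N³` always), **`avg_gain_mixture_ge`** (averaging over the solver's randomness with
  success mass `≥ s`: `≥ k((2s−1)b−1)(b−1)/N³` — Theorem 1's last display), `one_le_of_simple_instance`
  (with `s ≥ 3/4 + 1/(4b)` and `k ≥ 2(b−1)⁻²` the factor `k((2s−1)b−1)(b−1)` is `≥ 1`, i.e. the gain
  is `≥ N⁻³ = 2⁻³ⁿ`), `gain_factor_pos_iff` (for `b > 1`, `k > 0`: the bound is positive iff
  `s > 1/2 + 1/(2b)`).
* The relabelling step: `shift_average` (for an ensemble `μ` on circuits invariant under a family of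
  relabelling bijections `sh z`, `𝔼_C 𝔼_z F(sh z C, z) = 𝔼_{C'} 𝔼_z F(C', z)`) and the assembled
  **`expected_gain_ge`**: for such an ensemble with `p_{sh z C}(z) = p_C(x₀)`, a randomised solver
  whose success event has `μ`-mass `≥ s`, the reduction's estimate of `p_C(x₀)` gains at least
  `k((2s−1)b−1)(b−1)/N³` in mean squared error over the trivial estimate `1/N`
  [cite: AaronsonGunn2020, Theorem 1].
* `integral_sq_mul_exp_neg` — the Porter–Thomas heuristic behind “we expect an ideal circuit to solve
  XHOG with `b ≈ 2`”: `∫₀^∞ x² e^{−x} dx = 2` [cite: AaronsonGunn2020, §2 (display “≈ ∫₀^∞ (x/2ⁿ) x e^{−x} dx = 2/2ⁿ”)].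

## Not formalised

Running time / “polynomial-time”; XQUATH itself (an assumption, not a result — it would be an
`@[conjecture]` obligation under `Summits/`, not Literature); the Appendix (Chebyshev estimate of the
failure probability — its variance `(1 + 2F − F²)/2²ⁿ` is `XEBSampleComplexity.wvar_xebScore_depolarize`
— and the KL/Pinsker remark on uniformly random sampling).
-/

noncomputable section

namespace Literature.Computability.QuantumComplexity

namespace XHOGReduction

open Finset

variable {G : Type*} [Fintype G] [DecidableEq G]

/-! ## XHOG score, the reduction's estimate, and the gain `X` -/

/-- The XHOG score `𝔼ᵢ[|⟨zᵢ|C|0ⁿ⟩|²] = (Σ_{z∈S} p(z))/k` of `k = |S|` distinct samples `S` against the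
output distribution `p`. [cite: AaronsonGunn2020, §2 Problem 1 (XHOG)] -/
def xhogScore (p : G → ℝ) (S : Finset G) : ℝ := (∑ z ∈ S, p z) / S.card

/-- `S` solves XHOG with parameter `b`: `𝔼ᵢ[|⟨zᵢ|C|0ⁿ⟩|²] ≥ b/2ⁿ` (`N = |G| = 2ⁿ`).
[cite: AaronsonGunn2020, §2 Problem 1 (XHOG)] -/
def XHOGSolves (p : G → ℝ) (S : Finset G) (b : ℝ) : Prop :=
  b / (Fintype.card G : ℝ) ≤ xhogScore p S

/-- The reduction's estimate of `p₀`: “If `z ∈ {zᵢ}`, then our algorithm outputs `p = b2⁻ⁿ`;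
otherwise it outputs `p = 2⁻ⁿ`.” [cite: AaronsonGunn2020, §3 proof of Theorem 1] -/
def agEstimate (S : Finset G) (b : ℝ) (z : G) : ℝ :=
  if z ∈ S then b / (Fintype.card G : ℝ) else 1 / (Fintype.card G : ℝ)

/-- The gain `X = (p₀ − 2⁻ⁿ)² − (p₀ − p)²` of the reduction's estimate over the trivial one, as a
function of the hidden shift `z` (so that `p₀ = p_{C'}(z)`). [cite: AaronsonGunn2020, §3 proof of Theorem 1 (“Let X = (p₀ − 2⁻ⁿ)² − (p₀ − p)²”)] -/
def gain (p : G → ℝ) (S : Finset G) (b : ℝ) (z : G) : ℝ :=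
  (p z - 1 / (Fintype.card G : ℝ)) ^ 2 - (p z - agEstimate S b z) ^ 2

/-- Off the sample set the estimate is the trivial one: `𝔼[X | z ∉ {zᵢ}] = 0`.
[cite: AaronsonGunn2020, §3 proof of Theorem 1 (“Since 𝔼[X | z ∉ {zᵢ}] = 0”)] -/
theorem gain_of_not_mem {p : G → ℝ} {S : Finset G} {b : ℝ} {z : G} (hz : z ∉ S) :
    gain p S b z = 0 := by
  simp [gain, agEstimate, hz]

/-- On the sample set: `X = 2·2⁻ⁿ(b−1)·p₀ + 2⁻²ⁿ(1−b²)` (the first line of the display, before taking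
the conditional expectation of `p₀`). [cite: AaronsonGunn2020, §3 proof of Theorem 1 (display, line 1)] -/
theorem gain_of_mem {p : G → ℝ} {S : Finset G} {b : ℝ} {z : G} (hz : z ∈ S) :
    gain p S b z = 2 * (b - 1) / (Fintype.card G : ℝ) * p z +
      (1 - b ^ 2) / (Fintype.card G : ℝ) ^ 2 := by
  simp only [gain, agEstimate, if_pos hz]
  ring

/-- **The expected gain for a uniformly random hidden shift**:
`𝔼_z[X] = (k/N)·(2(b−1)/N · score + (1−b²)/N²)` — “`z` is uniformly random even conditioned on the
output of `A`”, so `Pr[z ∈ {zᵢ}] = k/N` and `𝔼[p₀ | z ∈ {zᵢ}]` is the XHOG score.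
[cite: AaronsonGunn2020, §3 proof of Theorem 1 (display)] -/
theorem avg_gain_eq [Nonempty G] (p : G → ℝ) (S : Finset G) (b : ℝ) :
    (∑ z, gain p S b z) / (Fintype.card G : ℝ) =
      (S.card : ℝ) / (Fintype.card G : ℝ) *
        (2 * (b - 1) / (Fintype.card G : ℝ) * xhogScore p S +
          (1 - b ^ 2) / (Fintype.card G : ℝ) ^ 2) := by
  have hN : (0 : ℝ) < Fintype.card G := by exact_mod_cast Fintype.card_pos
  -- only `z ∈ S` contributes
  have hsplit : ∑ z, gain p S b z = ∑ z ∈ S, gain p S b z := by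
    rw [← sum_filter_of_ne (s := univ) (p := fun z => z ∈ S)
      (fun z _ hz => by by_contra h; exact hz (gain_of_not_mem h))]
    congr 1; ext z; simp
  rw [hsplit, sum_congr rfl fun z hz => gain_of_mem hz, sum_add_distrib, sum_const, ← mul_sum,
    nsmul_eq_mul]
  unfold xhogScore
  by_cases hk : S.card = 0
  · rw [card_eq_zero.1 hk]; simp
  · have hk' : (S.card : ℝ) ≠ 0 := by exact_mod_cast hk
    field_simp

/-- **Success branch**: if the samples solve XHOG then `𝔼_z[X] ≥ k(b−1)²/N³`
(“`≥ 2·2⁻ⁿ(b−1)(b2⁻ⁿ) + 2⁻²ⁿ(1−b²) = 2⁻²ⁿ(b−1)²`”, times `Pr[z ∈ {zᵢ}] = k/2ⁿ`).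
[cite: AaronsonGunn2020, §3 proof of Theorem 1 (display, lines 2–3)] -/
theorem avg_gain_ge_of_solves [Nonempty G] {p : G → ℝ} {S : Finset G} {b : ℝ} (hb : 1 ≤ b)
    (h : XHOGSolves p S b) :
    (S.card : ℝ) * (b - 1) ^ 2 / (Fintype.card G : ℝ) ^ 3 ≤
      (∑ z, gain p S b z) / (Fintype.card G : ℝ) := by
  have hN : (0 : ℝ) < Fintype.card G := by exact_mod_cast Fintype.card_pos
  rw [avg_gain_eq]
  unfold XHOGSolves at h
  have h1 : 2 * (b - 1) / (Fintype.card G : ℝ) * (b / (Fintype.card G : ℝ)) ≤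
      2 * (b - 1) / (Fintype.card G : ℝ) * xhogScore p S :=
    mul_le_mul_of_nonneg_left h (by apply div_nonneg <;> linarith)
  calc (S.card : ℝ) * (b - 1) ^ 2 / (Fintype.card G : ℝ) ^ 3
      = (S.card : ℝ) / (Fintype.card G : ℝ) *
          (2 * (b - 1) / (Fintype.card G : ℝ) * (b / (Fintype.card G : ℝ)) +
            (1 - b ^ 2) / (Fintype.card G : ℝ) ^ 2) := by
        field_simp; ring
    _ ≤ _ := mul_le_mul_of_nonneg_left (by linarith) (by positivity)

/-- **Failure branch**: for any samples and any output distribution, `𝔼_z[X] ≥ −k(b²−1)/N³`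
(“`𝔼[X | z ∈ {zᵢ} and A failed] ≥ −2⁻²ⁿ(b²−1)`”). [cite: AaronsonGunn2020, §3 proof of Theorem 1 (display, lines 4–5)] -/
theorem avg_gain_ge_of_nonneg [Nonempty G] {p : G → ℝ} (hp : ∀ z, 0 ≤ p z) (S : Finset G) {b : ℝ}
    (hb : 1 ≤ b) :
    -((S.card : ℝ) * (b ^ 2 - 1) / (Fintype.card G : ℝ) ^ 3) ≤
      (∑ z, gain p S b z) / (Fintype.card G : ℝ) := by
  have hN : (0 : ℝ) < Fintype.card G := by exact_mod_cast Fintype.card_pos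
  rw [avg_gain_eq]
  have hsc : 0 ≤ xhogScore p S := by
    unfold xhogScore; exact div_nonneg (sum_nonneg fun z _ => hp z) (Nat.cast_nonneg _)
  have h1 : 0 ≤ 2 * (b - 1) / (Fintype.card G : ℝ) * xhogScore p S := by
    apply mul_nonneg _ hsc; apply div_nonneg <;> linarith
  calc -((S.card : ℝ) * (b ^ 2 - 1) / (Fintype.card G : ℝ) ^ 3)
      = (S.card : ℝ) / (Fintype.card G : ℝ) * (0 + (1 - b ^ 2) / (Fintype.card G : ℝ) ^ 2) := by
        field_simp; ring
    _ ≤ _ := mul_le_mul_of_nonneg_left (by linarith) (by positivity)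

/-! ## Averaging over the solver's randomness: Theorem 1's bound -/

variable {Ω : Type*} [Fintype Ω]

/-- **Theorem 1's display.**  Average the two branches over the solver's internal randomness `ω`
(weights `α ≥ 0` summing to one, every answer a set of `k` distinct strings): if a set `good` of
outcomes on which XHOG is solved has mass at least `s` (“`A` succeeded” with probability `≥ s`), then
`𝔼[X] ≥ k·s·(b−1)²/N³ − k·(1−s)·(b²−1)/N³ = k((2s−1)b−1)(b−1)/N³`.
[cite: AaronsonGunn2020, Theorem 1 (proof, final display “𝔼[X] ≥ 2⁻³ⁿ k((2s−1)b−1)(b−1)”)] -/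
theorem avg_gain_mixture_ge [Nonempty G] [DecidableEq Ω] {p : G → ℝ} (hp : ∀ z, 0 ≤ p z) {b : ℝ}
    (hb : 1 ≤ b) (α : Ω → ℝ) (hα0 : ∀ ω, 0 ≤ α ω) (hα1 : ∑ ω, α ω = 1) (S : Ω → Finset G)
    {k : ℕ} (hk : ∀ ω, (S ω).card = k) (good : Finset Ω)
    (hgood : ∀ ω ∈ good, XHOGSolves p (S ω) b) {s : ℝ} (hs : s ≤ ∑ ω ∈ good, α ω) :
    (k : ℝ) * ((2 * s - 1) * b - 1) * (b - 1) / (Fintype.card G : ℝ) ^ 3 ≤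
      ∑ ω, α ω * ((∑ z, gain p (S ω) b z) / (Fintype.card G : ℝ)) := by
  have hN : (0 : ℝ) < Fintype.card G := by exact_mod_cast Fintype.card_pos
  set bad := goodᶜ with hbad
  set A : ℝ := (k : ℝ) * (b - 1) ^ 2 / (Fintype.card G : ℝ) ^ 3 with hA
  set B : ℝ := (k : ℝ) * (b ^ 2 - 1) / (Fintype.card G : ℝ) ^ 3 with hB
  have hsplit : ∑ ω, α ω * ((∑ z, gain p (S ω) b z) / (Fintype.card G : ℝ)) =
      ∑ ω ∈ good, α ω * ((∑ z, gain p (S ω) b z) / (Fintype.card G : ℝ)) +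
        ∑ ω ∈ bad, α ω * ((∑ z, gain p (S ω) b z) / (Fintype.card G : ℝ)) :=
    (sum_add_sum_compl good _).symm
  have hmass : ∑ ω ∈ good, α ω + ∑ ω ∈ bad, α ω = 1 := by
    rw [sum_add_sum_compl]; exact hα1
  have hgoodle : ∑ ω ∈ good, α ω ≤ 1 := by
    have : 0 ≤ ∑ ω ∈ bad, α ω := sum_nonneg fun ω _ => hα0 ω
    linarith
  -- success branch, weighted
  have h1 : A * ∑ ω ∈ good, α ω ≤
      ∑ ω ∈ good, α ω * ((∑ z, gain p (S ω) b z) / (Fintype.card G : ℝ)) := by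
    rw [mul_sum]
    refine sum_le_sum fun ω hω => ?_
    rw [mul_comm]
    refine mul_le_mul_of_nonneg_left ?_ (hα0 ω)
    have := avg_gain_ge_of_solves (S := S ω) hb (hgood ω hω)
    rw [hk ω] at this; exact this
  -- failure branch, weighted
  have h2 : -B * ∑ ω ∈ bad, α ω ≤
      ∑ ω ∈ bad, α ω * ((∑ z, gain p (S ω) b z) / (Fintype.card G : ℝ)) := by
    rw [mul_sum]
    refine sum_le_sum fun ω _ => ?_
    rw [mul_comm]
    refine mul_le_mul_of_nonneg_left ?_ (hα0 ω)
    have := avg_gain_ge_of_nonneg hp (S ω) hb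
    rw [hk ω] at this; exact this
  have hA0 : 0 ≤ A := by rw [hA]; positivity
  have hB0 : 0 ≤ B := by
    rw [hB]; apply div_nonneg _ (by positivity); apply mul_nonneg (Nat.cast_nonneg _); nlinarith
  -- combine: the bound is affine increasing in the success mass
  calc (k : ℝ) * ((2 * s - 1) * b - 1) * (b - 1) / (Fintype.card G : ℝ) ^ 3
      = A * s - B * (1 - s) := by rw [hA, hB]; field_simp; ring
    _ ≤ A * (∑ ω ∈ good, α ω) - B * (1 - ∑ ω ∈ good, α ω) := by nlinarith
    _ = A * (∑ ω ∈ good, α ω) + -B * ∑ ω ∈ bad, α ω := by rw [← hmass]; ring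
    _ ≤ _ := by rw [hsplit]; exact add_le_add h1 h2

/-- “One simple instance of the theorem is to take `s = 3/4 + 1/(4b)` and `k = 2(b−1)⁻²`”: then
`k((2s−1)b−1)(b−1) ≥ 1`, so the gain is at least `N⁻³ = 2⁻³ⁿ` — the `Ω(2⁻³ⁿ)` that contradicts
XQUATH. [cite: AaronsonGunn2020, §3 (remark after Theorem 1)] -/
theorem one_le_of_simple_instance {b s k : ℝ} (hb : 1 < b) (hs : 3 / 4 + 1 / (4 * b) ≤ s)
    (hk : 2 / (b - 1) ^ 2 ≤ k) : 1 ≤ k * ((2 * s - 1) * b - 1) * (b - 1) := by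
  have hb1 : 0 < b - 1 := by linarith
  have hb0 : 0 < b := by linarith
  have hs' : (b - 1) / 2 ≤ (2 * s - 1) * b - 1 := by
    have : (3 / 4 + 1 / (4 * b)) * b = 3 * b / 4 + 1 / 4 := by field_simp
    nlinarith [mul_le_mul_of_nonneg_right hs hb0.le]
  have hk0 : 0 < k := lt_of_lt_of_le (by positivity) hk
  calc (1 : ℝ) = 2 / (b - 1) ^ 2 * ((b - 1) / 2) * (b - 1) := by field_simp
    _ ≤ k * ((b - 1) / 2) * (b - 1) := by gcongr
    _ ≤ k * ((2 * s - 1) * b - 1) * (b - 1) := by gcongr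

/-- For `b > 1` and `k > 0` the bound of Theorem 1 is positive exactly when `s > 1/2 + 1/(2b)` —
the threshold in the theorem's statement. [cite: AaronsonGunn2020, Theorem 1 (statement, “s > 1/2 + 1/2b”)] -/
theorem gain_factor_pos_iff {b s k : ℝ} (hb : 1 < b) (hk : 0 < k) :
    0 < k * ((2 * s - 1) * b - 1) * (b - 1) ↔ 1 / 2 + 1 / (2 * b) < s := by
  have hb1 : 0 < b - 1 := by linarith
  have hb0 : 0 < b := by linarith
  rw [mul_assoc, mul_pos_iff_of_pos_left hk, mul_pos_iff_of_pos_right hb1]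
  constructor
  · intro h
    have : 1 / 2 + 1 / (2 * b) = (b + 1) / (2 * b) := by field_simp
    rw [this, div_lt_iff₀ (by positivity)]
    linarith
  · intro h
    have : 1 / 2 + 1 / (2 * b) = (b + 1) / (2 * b) := by field_simp
    rw [this, div_lt_iff₀ (by positivity)] at h
    linarith

/-! ## The relabelling step and the assembled reduction -/

variable {C : Type*} [Fintype C]

omit [DecidableEq G] in
/-- **Relabelling invariance.**  If the circuit ensemble `μ` is invariant under each relabelling
bijection `sh z` (“`C'` is distributed exactly the same as `C`, even conditioned on a particular
`z`”), then averaging any quantity of the relabelled circuit and the shift equals averaging it over an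
independent pair. [cite: AaronsonGunn2020, §2 (“any distribution 𝒟 … unaffected by appending NOT gates”) and §3 proof of Theorem 1] -/
theorem shift_average (μ : C → ℝ) (sh : G → C ≃ C) (hμ : ∀ z c, μ (sh z c) = μ c)
    (F : C → G → ℝ) :
    ∑ c, μ c * ∑ z, F (sh z c) z = ∑ c, μ c * ∑ z, F c z := by
  simp only [mul_sum]
  rw [sum_comm]
  conv_rhs => rw [sum_comm]
  refine sum_congr rfl fun z _ => ?_
  -- reindex `c ↦ sh z c`, using `μ (sh z c) = μ c`
  calc ∑ c, μ c * F (sh z c) z = ∑ c, μ (sh z c) * F (sh z c) z :=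
        sum_congr rfl fun c _ => by rw [hμ z c]
    _ = ∑ c', μ c' * F c' z := Equiv.sum_comp (sh z) (fun c' => μ c' * F c' z)

/-- **Theorem 1 (the reduction), assembled.**  Circuits `c` are drawn from a finitely supported
ensemble `μ` invariant under the relabellings `sh z` (appending NOT gates), with output laws
`p c ≥ 0` satisfying `p_{sh z c}(z) = p_c(x₀)` (“`⟨0ⁿ|C|0ⁿ⟩ = ⟨z|C'|0ⁿ⟩`”); the solver, run on the
relabelled circuit, answers `S ω` (`k` distinct strings) with probability `α c' ω`, and a family of
success sets `good c'` (on which XHOG is solved with parameter `b`) has total mass at least `s`.  Then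
the reduction's estimate
of `p_c(x₀)` beats the trivial estimate `1/N` in mean squared error by at least
`k((2s−1)b−1)(b−1)/N³`:
`𝔼_c 𝔼_z 𝔼_ω[(p_c(x₀) − 1/N)² − (p_c(x₀) − p̂)²] ≥ k((2s−1)b−1)(b−1)/N³`.
[cite: AaronsonGunn2020, Theorem 1] -/
theorem expected_gain_ge [Nonempty G] [DecidableEq Ω] (μ : C → ℝ) (hμ0 : ∀ c, 0 ≤ μ c)
    (hμ1 : ∑ c, μ c = 1)
    (sh : G → C ≃ C) (hsh : ∀ z c, μ (sh z c) = μ c)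
    (p : C → G → ℝ) (hp : ∀ c x, 0 ≤ p c x) (x₀ : G) (hp0 : ∀ z c, p (sh z c) z = p c x₀)
    (α : C → Ω → ℝ) (hα0 : ∀ c ω, 0 ≤ α c ω) (hα1 : ∀ c, ∑ ω, α c ω = 1)
    (S : Ω → Finset G) {k : ℕ} (hk : ∀ ω, (S ω).card = k) {b s : ℝ} (hb : 1 ≤ b)
    (good : C → Finset Ω) (hgood : ∀ c, ∀ ω ∈ good c, XHOGSolves (p c) (S ω) b)
    (hs : s ≤ ∑ c, μ c * ∑ ω ∈ good c, α c ω) :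
    (k : ℝ) * ((2 * s - 1) * b - 1) * (b - 1) / (Fintype.card G : ℝ) ^ 3 ≤
      ∑ c, μ c * ((∑ z, ∑ ω, α (sh z c) ω *
        ((p c x₀ - 1 / (Fintype.card G : ℝ)) ^ 2 - (p c x₀ - agEstimate (S ω) b z) ^ 2)) /
          (Fintype.card G : ℝ)) := by
  have hN : (0 : ℝ) < Fintype.card G := by exact_mod_cast Fintype.card_pos
  -- Step 1 (relabelling): rewrite `p c x₀ = p (sh z c) z` and use the invariance of `μ`.
  have hrelabel : ∑ c, μ c * ((∑ z, ∑ ω, α (sh z c) ω *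
        ((p c x₀ - 1 / (Fintype.card G : ℝ)) ^ 2 - (p c x₀ - agEstimate (S ω) b z) ^ 2)) /
          (Fintype.card G : ℝ)) =
      ∑ c, μ c * ((∑ z, ∑ ω, α c ω * gain (p c) (S ω) b z) / (Fintype.card G : ℝ)) := by
    have hgain : ∀ c z ω, (p c x₀ - 1 / (Fintype.card G : ℝ)) ^ 2 -
        (p c x₀ - agEstimate (S ω) b z) ^ 2 = gain (p (sh z c)) (S ω) b z := by
      intro c z ω; simp only [gain, hp0]
    simp only [hgain]
    have h := shift_average μ sh hsh (fun c' z => ∑ ω, α c' ω * gain (p c') (S ω) b z)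
    beta_reduce at h
    simp only [← mul_div_assoc, ← sum_div]
    rw [h]
  rw [hrelabel]
  -- Step 2: for each circuit, Theorem 1's display with that circuit's success mass `s_c`.
  have hper : ∀ c, (k : ℝ) * ((2 * (∑ ω ∈ good c, α c ω) - 1) * b - 1) * (b - 1) /
      (Fintype.card G : ℝ) ^ 3 ≤
      (∑ z, ∑ ω, α c ω * gain (p c) (S ω) b z) / (Fintype.card G : ℝ) := by
    intro c
    have h := avg_gain_mixture_ge (hp c) hb (α c) (hα0 c) (hα1 c) S hk (good c) (hgood c) le_rfl
    rw [sum_comm, sum_div]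
    simpa [mul_div_assoc, mul_sum, sum_div] using h
  -- Step 3: average over circuits; the bound is affine in the success mass.
  calc (k : ℝ) * ((2 * s - 1) * b - 1) * (b - 1) / (Fintype.card G : ℝ) ^ 3
      ≤ (k : ℝ) * ((2 * (∑ c, μ c * ∑ ω ∈ good c, α c ω) - 1) * b - 1) * (b - 1) /
          (Fintype.card G : ℝ) ^ 3 := by
        have hb1 : 0 ≤ b - 1 := by linarith
        have hkb : 0 ≤ (k : ℝ) * b * (b - 1) := by positivity
        have : (k : ℝ) * ((2 * s - 1) * b - 1) * (b - 1) ≤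
            (k : ℝ) * ((2 * (∑ c, μ c * ∑ ω ∈ good c, α c ω) - 1) * b - 1) * (b - 1) := by
          nlinarith
        exact div_le_div_of_nonneg_right this (by positivity)
    _ = ∑ c, μ c * ((k : ℝ) * ((2 * (∑ ω ∈ good c, α c ω) - 1) * b - 1) * (b - 1) /
          (Fintype.card G : ℝ) ^ 3) := by
        -- affine in the mass, and Σ μ = 1
        have : ∀ t : ℝ, (k : ℝ) * ((2 * t - 1) * b - 1) * (b - 1) / (Fintype.card G : ℝ) ^ 3 =
            t * (2 * (k : ℝ) * b * (b - 1) / (Fintype.card G : ℝ) ^ 3) +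
              (-(k : ℝ) * (b + 1) * (b - 1) / (Fintype.card G : ℝ) ^ 3) := by
          intro t; field_simp; ring
        simp only [this, mul_add, sum_add_distrib, ← sum_mul, hμ1, one_mul]
        congr 1
        rw [sum_mul]
        refine sum_congr rfl fun c _ => ?_; ring
    _ ≤ _ := sum_le_sum fun c _ => mul_le_mul_of_nonneg_left (hper c) (hμ0 c)

/-! ## The Porter–Thomas heuristic `b ≈ 2` -/

/-- `∫₀^∞ x² e^{−x} dx = 2` (`= Γ(3) = 2!`): the arithmetic behind “we expect an ideal circuit to
solve XHOG with `b ≈ 2`” under the Porter–Thomas heuristic `Pr(p) = 2ⁿe^{−2ⁿp}`.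
[cite: AaronsonGunn2020, §2 (display “𝔼[|⟨z|C|0ⁿ⟩|²] ≈ ∫₀^∞ (x/2ⁿ) x e^{−x} dx = 2/2ⁿ”)] -/
theorem integral_sq_mul_exp_neg :
    ∫ x in Set.Ioi (0 : ℝ), Real.exp (-x) * x ^ (2 : ℕ) = 2 := by
  have h := Real.Gamma_eq_integral (s := 3) (by norm_num)
  have h3 : Real.Gamma 3 = 2 := by
    rw [show (3 : ℝ) = (2 : ℕ) + 1 by norm_num, Real.Gamma_nat_eq_factorial]
    norm_num
  rw [h3] at h
  rw [h]
  refine MeasureTheory.setIntegral_congr_fun measurableSet_Ioi fun x _ => ?_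
  rw [show (3 : ℝ) - 1 = ((2 : ℕ) : ℝ) by norm_num, Real.rpow_natCast]

end XHOGReduction

end Literature.Computability.QuantumComplexity
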